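import Literature.NumberTheory.Automorphic.HenniartAutomorphicInductionProofs
import Literature.NumberTheory.Automorphic.HarishChandraGLParameterOfCharacter
import HarnessLib

/-!
# Henniart's archimedean automorphic-induction statement: induction in stages
(reduction of `Henniart2012_infinityType_of_automorphicInduction` to prime degree; theorems only)

Topic `NumberTheory/Automorphic`; a proof file (theorems only: no definition, no named fact, no
instance) next to `HenniartAutomorphicInduction` / `HenniartAutomorphicInductionProofs`.

Henniart 2012 proves the local–global compatibility of base change (Thm. 4) and of automorphic
induction (Thm. 5, and its archimedean case, Remarque finale de §3.7) for a cyclic extension of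
ANY degree `d` by reduction to PRIME degree through a tower of cyclic sub-extensions (§3.1: "le cas
général du théorème 4 découlant alors, par extensions cycliques successives de degré premier, du
cas où `d` est premier"), using the transitivity of the global operations ("par construction le
changement de base global est transitif"). This file formalises that reduction for the named fact
`Henniart2012_infinityType_of_automorphicInduction` (the archimedean components of `τ^{L/K}` read
on infinity types) in the tree's Borel–Jacquet datum model:

* `IsAutomorphicInductionAlong.of_tower` — **transitivity read backwards** (finite places): in a
  tower `K ⊆ K₁ ⊆ L`, if `P` (over `K`) and `P₁` (over `K₁`) are both automorphically induced from
  `τ` (over `L`) in the sense of Arthur–Clozel's Def. 6.1 a.e., then `P` is automorphically induced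
  from `P₁` along `K₁/K` (`inducedSatakePolynomial_tower` and uniqueness of Satake parameters,
  Flath). Companion of the tree's `IsAutomorphicInductionAlong.trans`.
* `sum_filter_comp_algebraMap_tower` — the embeddings `σ'' : L → ℂ` over `σ : K → ℂ` are the
  disjoint union over the `σ' : K₁ → ℂ` over `σ` of the `σ''` over `σ'`; hence
  `henniartIdentity_tower`: Henniart's identity `(T_P σ).map a = ∑_{σ'' ∣ σ} (T_τ σ'').map a`
  composes in towers (archimedean side of induction in stages: restriction of Langlands parameters
  to `ℂ^× ⊆ W_{L_w} ⊆ W_{K₁,u} ⊆ W_{K_v}` is transitive).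
* `Henniart2012_infinityType_of_automorphicInduction_of_prime` — **the named fact from its
  prime-degree and degree-one instances**, granted (i) Henniart's Thm. 3 / §2.6 in the datum
  model: when a CUSPIDAL `P` over `K` is automorphically induced from a cuspidal `τ` over `L`, for
  every intermediate `K ⊆ K₁ ⊆ L` some CUSPIDAL `P₁` over `K₁` is automorphically induced from `τ`
  (`τ^{L/K₁}`, cuspidal since `P ≅ τ^{L/K}` is: trivial stabiliser of `τ`, §2.6 with §2.1),
  and (ii) existence of infinity types (Clozel 1990 §3.3, the tree's named fact
  `AutomorphicRepData.exists_hasInfinityType`, passed as a hypothesis). Proof by strong induction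
  on `d = [L : K]` through an intermediate field of prime index (a subgroup of prime order of the
  cyclic Galois group), as in the tree's `automorphicInduction_cyclic_of_leaves`.
* `Henniart2012_infinityType_of_automorphicInduction_of_prime_general` — the variant in which the
  intermediate inductions are supplied by Arthur–Clozel's Thm. 6.2 (the tree's named fact
  `automorphicInduction_cyclic`, weak inductions, not necessarily cuspidal) and the prime-degree
  hypothesis is accordingly stated for general automorphic data (true in print by the rigidity of
  archimedean infinitesimal characters in a near-equivalence class: Langlands 1979 Prop. 2 with
  Jacquet–Shalika 1981 Thm. 4.4); the tower is cut at the bottom (`[K₁ : K]` prime).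
* `Henniart2012_infinityType_of_automorphicInduction_of_prime_archParameter` — the same reduction
  run on archimedean (Harish-Chandra) parameters (`AutomorphicRepData.HasArchParameter`, the level
  of `ArthurClozel1989_strongLifting_archimedean`), so that the existence input is only that every
  automorphic representation has an archimedean parameter.
* `Henniart2012_infinityType_of_automorphicInduction_of_prime_schur` — the same with the existence
  input discharged down to **Schur's lemma for automorphic representations** (`Z(𝔤)` acts on
  `W / W'` by a character, `AutomorphicRepData.HasInfinitesimalCharacter`), by
  `AutomorphicRepData.exists_hasArchParameter_of_hasInfinitesimalCharacter`
  (`HarishChandraGLParameterOfCharacter`: an infinitesimal character yields Harish-Chandra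
  parameters at all places, through Harish-Chandra's isomorphism).

Nothing here discharges the named fact: its prime-degree instance is Arthur–Clozel's strong
lifting (Ch. 3 Thm. 5.1 with Ch. 1 §7) for the non-cuspidal lift `BC(P) = τ × τ^σ × ⋯` together
with Henniart 2010 (archimedean local automorphic induction), which the tree does not have.

## References

* G. Henniart, *Induction automorphe globale pour les corps de nombres*, Bull. Soc. Math. France
  140 (2012) 1–17: §1.10, §2.1, §2.6, Thm. 3, §3.1 (reduction to prime degree by stages), Thm. 5
  and Remarque finale de §3.7. [Henniart2012]
* J. Arthur, L. Clozel, Ann. of Math. Stud. 120 (1989), Ch. 3, §6, proof of Thm. 6.2 ("induction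
  by stages"), Def. 6.1. [ArthurClozelAMS120]
* L. Clozel, *Motifs et formes automorphes* (1990), §3.3. [Clozel1990]
-/

noncomputable section

open scoped NumberField Polynomial Classical
open NumberField IsDedekindDomain Polynomial Filter Finset Literature.NumberTheory.Automorphic

namespace Literature.NumberTheory.Automorphic

/-! ### Finite places: transitivity of automorphic induction, read backwards -/

section Tower

variable {K : Type} [Field K] [NumberField K] {K₁ : Type} [Field K₁] [NumberField K₁]
  {L : Type} [Field L] [NumberField L] [Algebra K K₁] [Algebra K₁ L] [Algebra K L]
  [IsScalarTower K K₁ L] {N N₁ n : ℕ} {hK : isCompact_glFiniteIntegralLevel N K}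
  {hK₁ : isCompact_glFiniteIntegralLevel N₁ K₁} {hL : isCompact_glFiniteIntegralLevel n L}
  {P : AutomorphicRepData (AutomorphyDatum.gl N K hK)}
  {P₁ : AutomorphicRepData (AutomorphyDatum.gl N₁ K₁ hK₁)}
  {τ : AutomorphicRepData (AutomorphyDatum.gl n L hL)}

/-- **Automorphic induction in stages, read backwards** (Henniart 2012, §3.1: the global
operations are transitive by construction, being defined by the `L`-factor relations (1.1);
Arthur–Clozel 1989, Ch. 3, §6, "induction by stages"). In a tower `K ⊆ K₁ ⊆ L` of number fields:
if `P` on `GL_N(𝔸_K)` and `P₁` on `GL_{N₁}(𝔸_{K₁})` are both automorphically induced (Def. 6.1,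
a.e.) from `τ` on `GL_n(𝔸_L)`, then `P` is automorphically induced from `P₁` along `K₁/K`: at
almost every `v`, `P_{t_{P,v}} = ∏_{w ∣ v} P_{t_{τ,w}}(X^{f(w|v)})
= ∏_{u ∣ v} (∏_{w ∣ u} P_{t_{τ,w}}(X^{f(w|u)}))(X^{f(u|v)}) = ∏_{u ∣ v} P_{t_{P₁,u}}(X^{f(u|v)})`
(`inducedSatakePolynomial_tower`; the Satake parameter of `P₁` at `u` is unique, Flath).
[cite: Henniart2012, §3.1] [cite: ArthurClozelAMS120, Ch. 3, §6, proof of Thm. 6.2] -/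
theorem IsAutomorphicInductionAlong.of_tower (h : IsAutomorphicInductionAlong τ P)
    (h₁ : IsAutomorphicInductionAlong τ P₁) : IsAutomorphicInductionAlong P₁ P := by
  filter_upwards [h, eventually_forall_under_eq (F := K) h₁,
    τ.eventually_exists_forall_hasSatakeParamAt_above (K := K)] with v hv hv₁ hβ β₁ hβ₁
  obtain ⟨β, hβ⟩ := hβ
  obtain ⟨α, hα, hαβ⟩ := hv β hβ
  refine ⟨α, hα, ?_⟩
  rw [hαβ, ← inducedSatakePolynomial_tower (E₁ := K₁) v β, inducedSatakePolynomial_def v β₁]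
  refine finprod_mem_congr rfl fun u hu => ?_
  -- at `u ∣ v`: the parameter `β₁ u` of `P₁` is the one induced from the `t_{τ,w}`, `w ∣ u`
  obtain ⟨α₁, hα₁, hα₁β⟩ := hv₁ u hu β fun w hw => hβ w (by
    rw [← Ideal.under_under (B := 𝓞 K₁) w.asIdeal, hw, hu])
  rw [P₁.hasSatakeParamAt_unique_holds (hβ₁ u hu) hα₁, hα₁β]

end Tower

/-! ### Archimedean side: embeddings over `σ` in a tower, and composition of the identity -/

section Embeddings

variable {K : Type*} [Field K] {K₁ : Type*} [Field K₁] {L : Type*} [Field L]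
  [Algebra K K₁] [Algebra K₁ L] [Algebra K L] [IsScalarTower K K₁ L]
  [Fintype (K₁ →+* ℂ)] [Fintype (L →+* ℂ)]

omit [Fintype (K₁ →+* ℂ)] [Fintype (L →+* ℂ)] in
variable (K K₁) in
/-- In a tower `K ⊆ K₁ ⊆ L`, restriction to `K` factors through restriction to `K₁`:
`σ''|_K = (σ''|_{K₁})|_K`. [folklore] -/
theorem comp_algebraMap_tower (σ'' : L →+* ℂ) :
    σ''.comp (algebraMap K L) = (σ''.comp (algebraMap K₁ L)).comp (algebraMap K K₁) := by
  rw [RingHom.comp_assoc, ← IsScalarTower.algebraMap_eq]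

variable (K K₁ L) in
/-- **The embeddings of `L` over `σ : K → ℂ` are the disjoint union, over the embeddings `σ'` of
`K₁` over `σ`, of the embeddings of `L` over `σ'`**: a sum over `{σ'' : L → ℂ ∣ σ''|_K = σ}`
is the iterated sum (Mathlib `Finset.sum_fiberwise_of_maps_to` for `σ'' ↦ σ''|_{K₁}`).
Archimedean counterpart of `inducedSatakePolynomial_tower`. [folklore] -/
theorem sum_filter_comp_algebraMap_tower {M : Type*} [AddCommMonoid M] (f : (L →+* ℂ) → M)
    (σ : K →+* ℂ) :
    ∑ σ'' ∈ Finset.univ.filter (fun σ'' : L →+* ℂ => σ''.comp (algebraMap K L) = σ), f σ'' =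
      ∑ σ' ∈ Finset.univ.filter (fun σ' : K₁ →+* ℂ => σ'.comp (algebraMap K K₁) = σ),
        ∑ σ'' ∈ Finset.univ.filter (fun σ'' : L →+* ℂ => σ''.comp (algebraMap K₁ L) = σ'),
          f σ'' := by
  rw [← Finset.sum_fiberwise_of_maps_to
    (s := Finset.univ.filter (fun σ'' : L →+* ℂ => σ''.comp (algebraMap K L) = σ))
    (t := Finset.univ.filter (fun σ' : K₁ →+* ℂ => σ'.comp (algebraMap K K₁) = σ))
    (g := fun σ'' : L →+* ℂ => σ''.comp (algebraMap K₁ L)) ?_]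
  · refine Finset.sum_congr rfl fun σ' hσ' => Finset.sum_congr ?_ fun _ _ => rfl
    ext σ''
    simp only [Finset.mem_filter, Finset.mem_univ, true_and]
    constructor
    · rintro ⟨-, h⟩
      exact h
    · intro h
      refine ⟨?_, h⟩
      rw [comp_algebraMap_tower K K₁ σ'', h]
      exact (Finset.mem_filter.mp hσ').2
  · intro σ'' hσ''
    simp only [Finset.mem_filter, Finset.mem_univ, true_and] at hσ'' ⊢
    rw [← hσ'']
    exact (comp_algebraMap_tower K K₁ σ'').symm

/-- **Henniart's identity composes in towers** (archimedean side of induction in stages: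
restricting a Langlands parameter to `ℂ^× ⊆ W_{L_w} ⊆ W_{(K₁)_u} ⊆ W_{K_v}` in two steps or one
is the same). If `(T_P σ).map a = ∑_{σ' ∣ σ} (T₁ σ').map a` for all `σ : K → ℂ` (identity along
`K₁/K`) and `(T₁ σ').map a = ∑_{σ'' ∣ σ'} (T_τ σ'').map a` for all `σ' : K₁ → ℂ` (identity along
`L/K₁`), then `(T_P σ).map a = ∑_{σ'' ∣ σ} (T_τ σ'').map a` (identity along `L/K`).
[cite: Henniart2012, §3.1 and Remarque §3.7] -/
theorem henniartIdentity_tower {N N₁ n : ℕ} {TP : InfinityType K N} {T₁ : InfinityType K₁ N₁}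
    {Tτ : InfinityType L n}
    (hP : ∀ σ : K →+* ℂ, (TP σ).map ArchWeight.a =
      ∑ σ' ∈ Finset.univ.filter (fun σ' : K₁ →+* ℂ => σ'.comp (algebraMap K K₁) = σ),
        (T₁ σ').map ArchWeight.a)
    (h₁ : ∀ σ' : K₁ →+* ℂ, (T₁ σ').map ArchWeight.a =
      ∑ σ'' ∈ Finset.univ.filter (fun σ'' : L →+* ℂ => σ''.comp (algebraMap K₁ L) = σ'),
        (Tτ σ'').map ArchWeight.a)
    (σ : K →+* ℂ) :
    (TP σ).map ArchWeight.a =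
      ∑ σ'' ∈ Finset.univ.filter (fun σ'' : L →+* ℂ => σ''.comp (algebraMap K L) = σ),
        (Tτ σ'').map ArchWeight.a := by
  rw [hP σ, sum_filter_comp_algebraMap_tower K K₁ L (fun σ'' => (Tτ σ'').map ArchWeight.a) σ]
  exact Finset.sum_congr rfl fun σ' _ => h₁ σ'

end Embeddings

/-! ### The named fact from its prime-degree and degree-one instances (Henniart §3.1) -/

section Reduction

/-- **Free rank.** An instance of Henniart's statement typed with `P` on `GL_{dn}(𝔸_K)`,
`d = [L : K]`, gives the instance for `P` of any rank `N`: the relation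
`IsAutomorphicInductionAlong π P` forces `N = n [L : K]` (`IsAutomorphicInductionAlong.rank_eq`).
[cite: ArthurClozelAMS120, Ch. 3 Def. 6.1] -/
theorem henniartInstance_of_rank_free {K L : Type} [Field K] [NumberField K] [Field L]
    [NumberField L] [Algebra K L] {n d : ℕ} (hd : Module.finrank K L = d)
    (h : ∀ (hK : isCompact_glFiniteIntegralLevel (d * n) K) (hL : isCompact_glFiniteIntegralLevel n L)
      (P : CuspidalAutomorphicRepData (d * n) K hK) (π : CuspidalAutomorphicRepData n L hL),
      IsAutomorphicInductionAlong π.1 P.1 →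
      ∀ (TP : InfinityType K (d * n)) (Tπ : InfinityType L n),
        P.1.HasInfinityType TP → π.1.HasInfinityType Tπ →
        ∀ σ : K →+* ℂ,
          (TP σ).map ArchWeight.a =
            ∑ σ' ∈ Finset.univ.filter (fun σ' : L →+* ℂ => σ'.comp (algebraMap K L) = σ),
              (Tπ σ').map ArchWeight.a)
    {N : ℕ} (hK : isCompact_glFiniteIntegralLevel N K) (hL : isCompact_glFiniteIntegralLevel n L)
    (P : CuspidalAutomorphicRepData N K hK) (π : CuspidalAutomorphicRepData n L hL)
    (hAI : IsAutomorphicInductionAlong π.1 P.1) (TP : InfinityType K N) (Tπ : InfinityType L n)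
    (hTP : P.1.HasInfinityType TP) (hTπ : π.1.HasInfinityType Tπ) (σ : K →+* ℂ) :
    (TP σ).map ArchWeight.a =
      ∑ σ' ∈ Finset.univ.filter (fun σ' : L →+* ℂ => σ'.comp (algebraMap K L) = σ),
        (Tπ σ').map ArchWeight.a := by
  obtain rfl : N = d * n := by rw [hAI.rank_eq, hd, Nat.mul_comm]
  exact h hK hL P π hAI TP Tπ hTP hTπ σ

/-- **Henniart's archimedean statement from its prime-degree and degree-one instances, by
induction in stages** (Henniart 2012, §3.1: the general cyclic case "découlant alors, par
extensions cycliques successives de degré premier, du cas où `d` est premier", by transitivity of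
the global operations; Thm. 5 and Remarque finale de §3.7 for automorphic induction). Granting, in
the tree's Borel–Jacquet datum model:
`hprime` — the named fact `Henniart2012_infinityType_of_automorphicInduction` for `[L : K]` PRIME
(hypothesis written with `IsAutomorphicInductionAlong`, equivalent to the fact's a.e. Satake
relation by `eventually_satakeRelation_iff_isAutomorphicInductionAlong`; in print this instance is
Henniart's Thm. 3 (i) with Thm. 4 — Arthur–Clozel's strong lifting, Ch. 3 Thm. 5.1 with Ch. 1 §7,
for the lift `BC(P) = τ × τ^σ × ⋯` — and the Remarque of §3.7, Henniart 2010, at the infinite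
places);
`hOne` — the instance `[L : K] = 1` (transport of structure along the field isomorphism `L ≅ K`,
distinct types here; cf. `hOne` of `automorphicInduction_cyclic_of_leaves`);
`hCusp` — Henniart's Thm. 3 with §2.6 and §2.1 (rigidity) in the datum model: if a CUSPIDAL
`P` over `K` is automorphically induced from a cuspidal `π` over `L` (`L/K` cyclic), then for
every intermediate field `K ⊆ K₁ ⊆ L` some CUSPIDAL `P₁` on `GL_{n[L:K₁]}(𝔸_{K₁})` is
automorphically induced from `π` (namely `π^{L/K₁}`: `P ≅ π^{L/K}` by rigidity, §2.1; by the
description of the cuspidal support of `τ^{E/F}` in §2.6, the automorphic induction of a cuspidal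
unitary `τ` is cuspidal iff the stabiliser of `τ` in the Galois group is trivial, a condition
inherited by the subgroup `Gal(L/K₁)`; non-unitary data by the twist `|det|^s`, §1.18);
`hInf` — every cuspidal automorphic representation has an infinity type (Clozel 1990, §3.3; the
tree's named fact `AutomorphicRepData.exists_hasInfinityType`):
the named fact holds in every degree.

Proof: strong induction on `d = [L : K] ≥ 2` (degree `1` is `hOne`). Prime `d`: `hprime`.
Composite `d`: choose `K ⊆ K₁ ⊆ L` with `[L : K₁] = p` prime (fixed field of a subgroup of order
`p` of the cyclic Galois group; `L/K₁`, `K₁/K` cyclic, `2 ≤ [K₁ : K] < d`); `hCusp` gives a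
cuspidal `P₁` over `K₁` induced from `π`; then `P` is induced from `P₁` along `K₁/K`
(`IsAutomorphicInductionAlong.of_tower`), `P₁` has an infinity type `T₁` (`hInf`), the induction
hypothesis gives the identities along `K₁/K` (for `P, P₁`) and along `L/K₁` (for `P₁, π`), and
they compose (`henniartIdentity_tower`).
[cite: Henniart2012, §3.1, Thm. 3, §2.6, Thm. 5 and Remarque §3.7]
[cite: ArthurClozelAMS120, Ch. 3 Thm. 5.1 and Ch. 1 §7] [cite: Clozel1990, §3.3] -/
theorem Henniart2012_infinityType_of_automorphicInduction_of_prime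
    (hprime : ∀ (K L : Type) [Field K] [NumberField K] [Field L] [NumberField L] [Algebra K L]
      [IsGalois K L], IsCyclic (L ≃ₐ[K] L) →
      ∀ (n d : ℕ), 0 < n → Module.finrank K L = d → d.Prime →
      ∀ (hK : isCompact_glFiniteIntegralLevel (d * n) K)
        (hL : isCompact_glFiniteIntegralLevel n L)
        (P : CuspidalAutomorphicRepData (d * n) K hK) (π : CuspidalAutomorphicRepData n L hL),
        IsAutomorphicInductionAlong π.1 P.1 →
        ∀ (TP : InfinityType K (d * n)) (Tπ : InfinityType L n),
          P.1.HasInfinityType TP → π.1.HasInfinityType Tπ →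
          ∀ σ : K →+* ℂ,
            (TP σ).map ArchWeight.a =
              ∑ σ' ∈ Finset.univ.filter (fun σ' : L →+* ℂ => σ'.comp (algebraMap K L) = σ),
                (Tπ σ').map ArchWeight.a)
    (hOne : ∀ (K L : Type) [Field K] [NumberField K] [Field L] [NumberField L] [Algebra K L],
      ∀ (n : ℕ), 0 < n → Module.finrank K L = 1 →
      ∀ (hK : isCompact_glFiniteIntegralLevel (1 * n) K)
        (hL : isCompact_glFiniteIntegralLevel n L)
        (P : CuspidalAutomorphicRepData (1 * n) K hK) (π : CuspidalAutomorphicRepData n L hL),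
        IsAutomorphicInductionAlong π.1 P.1 →
        ∀ (TP : InfinityType K (1 * n)) (Tπ : InfinityType L n),
          P.1.HasInfinityType TP → π.1.HasInfinityType Tπ →
          ∀ σ : K →+* ℂ,
            (TP σ).map ArchWeight.a =
              ∑ σ' ∈ Finset.univ.filter (fun σ' : L →+* ℂ => σ'.comp (algebraMap K L) = σ),
                (Tπ σ').map ArchWeight.a)
    (hCusp : ∀ (K K₁ L : Type) [Field K] [NumberField K] [Field K₁] [NumberField K₁] [Field L]
      [NumberField L] [Algebra K K₁] [Algebra K₁ L] [Algebra K L] [IsScalarTower K K₁ L]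
      [IsGalois K L], IsCyclic (L ≃ₐ[K] L) → ∀ (n N : ℕ), 0 < n →
      ∀ (hK : isCompact_glFiniteIntegralLevel N K)
        (hK₁ : isCompact_glFiniteIntegralLevel (Module.finrank K₁ L * n) K₁)
        (hL : isCompact_glFiniteIntegralLevel n L)
        (P : CuspidalAutomorphicRepData N K hK) (π : CuspidalAutomorphicRepData n L hL),
        IsAutomorphicInductionAlong π.1 P.1 →
        ∃ P₁ : CuspidalAutomorphicRepData (Module.finrank K₁ L * n) K₁ hK₁,
          IsAutomorphicInductionAlong π.1 P₁.1)
    (hInf : ∀ (N : ℕ) (K : Type) [Field K] [NumberField K]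
      (hK : isCompact_glFiniteIntegralLevel N K) (P : CuspidalAutomorphicRepData N K hK),
      P.1.exists_hasInfinityType) :
    Henniart2012_infinityType_of_automorphicInduction := by
  -- the statement for all cyclic `L/K` of a given degree `d ≥ 2` and `P` of free rank `N`
  have key : ∀ d : ℕ, 2 ≤ d → ∀ (K L : Type) [Field K] [NumberField K] [Field L]
      [NumberField L] [Algebra K L] [IsGalois K L], IsCyclic (L ≃ₐ[K] L) →
        Module.finrank K L = d → ∀ (n N : ℕ), 0 < n →
        ∀ (hK : isCompact_glFiniteIntegralLevel N K) (hL : isCompact_glFiniteIntegralLevel n L)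
          (P : CuspidalAutomorphicRepData N K hK) (π : CuspidalAutomorphicRepData n L hL),
          IsAutomorphicInductionAlong π.1 P.1 →
          ∀ (TP : InfinityType K N) (Tπ : InfinityType L n),
            P.1.HasInfinityType TP → π.1.HasInfinityType Tπ →
            ∀ σ : K →+* ℂ,
              (TP σ).map ArchWeight.a =
                ∑ σ' ∈ Finset.univ.filter (fun σ' : L →+* ℂ => σ'.comp (algebraMap K L) = σ),
                  (Tπ σ').map ArchWeight.a := by
    intro d
    induction d using Nat.strong_induction_on with
    | _ d IH =>
    intro hd2 K L _ _ _ _ _ _ hcyc hdL n N hn hK hL P π hAI TP Tπ hTP hTπ σ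
    haveI : FiniteDimensional K L := Module.Finite.of_restrictScalars_finite ℚ K L
    haveI := hcyc
    by_cases hdprime : d.Prime
    · /- prime degree: `hprime` -/
      exact henniartInstance_of_rank_free hdL
        (fun hK hL P π hAI => hprime K L hcyc n d hn hdL hdprime hK hL P π hAI)
        hK hL P π hAI TP Tπ hTP hTπ σ
    · /- composite degree: an intermediate field `K₁` with `[L : K₁] = p` prime -/
      obtain ⟨p, hp, hpd⟩ := Nat.exists_prime_and_dvd (show d ≠ 1 by omega)
      haveI : Fact p.Prime := ⟨hp⟩
      have hcardG : Nat.card (L ≃ₐ[K] L) = d := (IsGalois.card_aut_eq_finrank K L).trans hdL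
      obtain ⟨g, hg⟩ := exists_prime_orderOf_dvd_card' (G := L ≃ₐ[K] L) p (hcardG ▸ hpd)
      set H : Subgroup (L ≃ₐ[K] L) := Subgroup.zpowers g with hHdef
      have hH : Nat.card H = p := by rw [hHdef, Nat.card_zpowers, hg]
      -- `H` is normal (the Galois group is cyclic, hence commutative)
      haveI hHn : H.Normal := by
        refine ⟨fun h hh g' => ?_⟩
        obtain ⟨x, hx⟩ := IsCyclic.exists_generator (α := L ≃ₐ[K] L)
        obtain ⟨a, rfl⟩ := hx g'
        obtain ⟨b, rfl⟩ := hx h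
        rwa [← zpow_add, add_comm, zpow_add, mul_assoc, ← zpow_neg, ← zpow_add, add_neg_cancel,
          zpow_zero, mul_one]
      set K₁ : IntermediateField K L := IntermediateField.fixedField H with hK₁def
      haveI : IsGalois K K₁ := IsGalois.of_fixedField_normal_subgroup H
      haveI : NumberField K₁ := NumberField.of_module_finite K K₁
      haveI : IsGalois K₁ L := IsGalois.tower_top_of_isGalois K K₁ L
      have hdegL : Module.finrank K₁ L = p := by
        rw [hK₁def, IntermediateField.finrank_fixedField_eq_card, hH]
      have hdegK : Module.finrank K K₁ * p = d := by
        rw [← hdegL, Module.finrank_mul_finrank, hdL]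
      -- `Gal(L/K₁) ≅ H` and `Gal(K₁/K)` (a quotient of `Gal(L/K)`) are cyclic
      have hcycL : IsCyclic (L ≃ₐ[K₁] L) := by
        haveI : IsCyclic K₁.fixingSubgroup := Subgroup.isCyclic _
        exact isCyclic_of_surjective (IntermediateField.fixingSubgroupEquiv K₁)
          (IntermediateField.fixingSubgroupEquiv K₁).surjective
      have hcycK : IsCyclic (K₁ ≃ₐ[K] K₁) :=
        isCyclic_of_surjective (AlgEquiv.restrictNormalHom (F := K) (K₁ := L) K₁)
          (AlgEquiv.restrictNormalHom_surjective L)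
      -- `2 ≤ [K₁ : K] < d` and `2 ≤ p < d`
      have hd₁lt : Module.finrank K K₁ < d := by
        rw [← hdegK]
        exact lt_mul_of_one_lt_right (Nat.pos_of_ne_zero fun h0 => by
          rw [h0, zero_mul] at hdegK; omega) hp.one_lt
      have hd₁ : 2 ≤ Module.finrank K K₁ := by
        by_contra hlt
        have h0 : Module.finrank K K₁ ≠ 0 := fun h0 => by rw [h0, zero_mul] at hdegK; omega
        have : Module.finrank K K₁ = 1 := by omega
        rw [this, one_mul] at hdegK
        exact hdprime (hdegK ▸ hp)
      have hplt : p < d := by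
        rw [← hdegK]
        exact lt_mul_of_one_lt_left hp.pos (by omega)
      -- a cuspidal `P₁ = π^{L/K₁}` over `K₁`
      obtain ⟨P₁, hAI₁⟩ := hCusp K K₁ L hcyc n N hn hK (isCompact_glFiniteIntegralLevel_holds _ _)
        hL P π hAI
      -- `P` is induced from `P₁` along `K₁/K`; `P₁` has an infinity type
      have hAI' : IsAutomorphicInductionAlong P₁.1 P.1 := hAI.of_tower hAI₁
      obtain ⟨T₁, hT₁⟩ := hInf _ K₁ _ P₁
      -- the identities along `K₁/K` and along `L/K₁` (induction hypothesis), composed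
      have hdown := IH (Module.finrank K K₁) hd₁lt hd₁ K K₁ hcycK rfl
        (Module.finrank K₁ L * n) N (Nat.mul_pos (hdegL ▸ hp.pos) hn) hK
        (isCompact_glFiniteIntegralLevel_holds _ _) P P₁ hAI' TP T₁ hTP hT₁
      have hup := IH p hplt hp.two_le K₁ L hcycL hdegL n (Module.finrank K₁ L * n) hn
        (isCompact_glFiniteIntegralLevel_holds _ _) hL P₁ π hAI₁ T₁ Tπ hT₁ hTπ
      exact henniartIdentity_tower (K₁ := K₁) hdown hup σ
  -- the named fact: degree `1` by `hOne`, degree `≥ 2` by `key`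
  rw [Henniart2012_infinityType_of_automorphicInduction_iff_along]
  intro K L _ _ _ _ _ _ hcyc n d hn hd hK hL P π hAI TP Tπ hTP hTπ σ
  haveI : FiniteDimensional K L := Module.Finite.of_restrictScalars_finite ℚ K L
  rcases Nat.lt_or_ge d 2 with h1 | h2
  · obtain rfl : d = 1 := by
      have := Module.finrank_pos (R := K) (M := L); omega
    exact hOne K L n hn hd hK hL P π hAI TP Tπ hTP hTπ σ
  · exact key d h2 K L hcyc hd n (d * n) hn hK hL P π hAI TP Tπ hTP hTπ σ

end Reduction

/-! ### Variant: the intermediate inductions supplied by Arthur–Clozel's Thm. 6.2 (tree fact) -/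

section ReductionGeneral

/-- **Henniart's archimedean statement from its prime-degree instance for general automorphic
data, the intermediate inductions being Arthur–Clozel's** (Henniart 2012, §3.1, by stages, as in
`Henniart2012_infinityType_of_automorphicInduction_of_prime`; here the tower is cut at the BOTTOM,
`[K₁ : K]` prime, so that the datum induced along `L/K₁` is always the original cuspidal `π`).
Granting:
`hprime` — for `L/K` cyclic of PRIME degree, an automorphic representation `P` of `GL_N(𝔸_K)`
(an irreducible subquotient of the automorphic forms, not necessarily cuspidal) automorphically
induced (Def. 6.1 a.e.) from an automorphic representation `ϖ` of `GL_n(𝔸_L)` (not necessarily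
cuspidal) satisfies Henniart's identity on infinity types. In print: `ϖ` is nearly equivalent to
an isobaric `ρ₁ ⊞ ⋯ ⊞ ρ_r`, `ρ_j` cuspidal (Langlands 1979, Prop. 2), `P` is nearly equivalent to
the isobaric `ρ₁^{L/K} ⊞ ⋯ ⊞ ρ_r^{L/K}` (Henniart Thm. 3 and (1.1)), nearly equivalent automorphic
representations have associate cuspidal data (Jacquet–Shalika 1981, Thm. 4.4) hence the same
archimedean infinitesimal characters, and each `ρ_j^{L/K}` has the archimedean components of
Thm. 5 / Remarque §3.7 (Henniart 2010); so this hypothesis is the prime-degree archimedean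
statement of the source together with rigidity;
`hOne` — the degree-one instance of the named fact (as in `…_of_prime`);
`hAI` — Arthur–Clozel's Thm. 6.2, the tree's named fact `automorphicInduction_cyclic` (existence of
a weak automorphic induction of a cuspidal `π` through any cyclic extension);
`hInf` — existence of infinity types (Clozel 1990 §3.3; the tree's named fact
`AutomorphicRepData.exists_hasInfinityType`, for every automorphic representation):
the named fact `Henniart2012_infinityType_of_automorphicInduction` holds in every degree.

Proof: strong induction on `d = [L : K] ≥ 2` for the statement with `P` automorphic and `π`
cuspidal. Prime `d`: `hprime`. Composite `d`: `K ⊆ K₁ ⊆ L` with `[K₁ : K] = p` prime (fixed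
field of the subgroup of index `p` of the cyclic Galois group), `P₁` a weak automorphic induction
of `π` along `L/K₁` (`hAI`), so that `P` is induced from `P₁` along `K₁/K`
(`IsAutomorphicInductionAlong.of_tower`); the induction hypothesis along `L/K₁` (for `P₁, π`),
`hprime` along `K₁/K` (for `P, P₁`) and `henniartIdentity_tower` conclude.
[cite: Henniart2012, §3.1, Thm. 3, Thm. 5 and Remarque §3.7]
[cite: ArthurClozelAMS120, Ch. 3 Thm. 6.2] [cite: JacquetShalikaAJM1981II, Thm. 4.4]
[cite: Clozel1990, §3.3] -/
theorem Henniart2012_infinityType_of_automorphicInduction_of_prime_general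
    (hprime : ∀ (K L : Type) [Field K] [NumberField K] [Field L] [NumberField L] [Algebra K L]
      [IsGalois K L], IsCyclic (L ≃ₐ[K] L) → (Module.finrank K L).Prime →
      ∀ (n N : ℕ), 0 < n →
      ∀ (hK : isCompact_glFiniteIntegralLevel N K) (hL : isCompact_glFiniteIntegralLevel n L)
        (P : AutomorphicRepData (AutomorphyDatum.gl N K hK))
        (ϖ : AutomorphicRepData (AutomorphyDatum.gl n L hL)),
        IsAutomorphicInductionAlong ϖ P →
        ∀ (TP : InfinityType K N) (Tϖ : InfinityType L n),
          P.HasInfinityType TP → ϖ.HasInfinityType Tϖ →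
          ∀ σ : K →+* ℂ,
            (TP σ).map ArchWeight.a =
              ∑ σ' ∈ Finset.univ.filter (fun σ' : L →+* ℂ => σ'.comp (algebraMap K L) = σ),
                (Tϖ σ').map ArchWeight.a)
    (hOne : ∀ (K L : Type) [Field K] [NumberField K] [Field L] [NumberField L] [Algebra K L],
      ∀ (n : ℕ), 0 < n → Module.finrank K L = 1 →
      ∀ (hK : isCompact_glFiniteIntegralLevel (1 * n) K)
        (hL : isCompact_glFiniteIntegralLevel n L)
        (P : CuspidalAutomorphicRepData (1 * n) K hK) (π : CuspidalAutomorphicRepData n L hL),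
        IsAutomorphicInductionAlong π.1 P.1 →
        ∀ (TP : InfinityType K (1 * n)) (Tπ : InfinityType L n),
          P.1.HasInfinityType TP → π.1.HasInfinityType Tπ →
          ∀ σ : K →+* ℂ,
            (TP σ).map ArchWeight.a =
              ∑ σ' ∈ Finset.univ.filter (fun σ' : L →+* ℂ => σ'.comp (algebraMap K L) = σ),
                (Tπ σ').map ArchWeight.a)
    (hAI : automorphicInduction_cyclic)
    (hInf : ∀ (N : ℕ) (K : Type) [Field K] [NumberField K]
      (hK : isCompact_glFiniteIntegralLevel N K) (P : AutomorphicRepData (AutomorphyDatum.gl N K hK)),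
      P.exists_hasInfinityType) :
    Henniart2012_infinityType_of_automorphicInduction := by
  -- the statement for `L/K` cyclic of degree `d ≥ 2`, `P` automorphic of free rank, `π` cuspidal
  have key : ∀ d : ℕ, 2 ≤ d → ∀ (K L : Type) [Field K] [NumberField K] [Field L]
      [NumberField L] [Algebra K L] [IsGalois K L], IsCyclic (L ≃ₐ[K] L) →
        Module.finrank K L = d → ∀ (n N : ℕ), 0 < n →
        ∀ (hK : isCompact_glFiniteIntegralLevel N K) (hL : isCompact_glFiniteIntegralLevel n L)
          (P : AutomorphicRepData (AutomorphyDatum.gl N K hK))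
          (π : CuspidalAutomorphicRepData n L hL),
          IsAutomorphicInductionAlong π.1 P →
          ∀ (TP : InfinityType K N) (Tπ : InfinityType L n),
            P.HasInfinityType TP → π.1.HasInfinityType Tπ →
            ∀ σ : K →+* ℂ,
              (TP σ).map ArchWeight.a =
                ∑ σ' ∈ Finset.univ.filter (fun σ' : L →+* ℂ => σ'.comp (algebraMap K L) = σ),
                  (Tπ σ').map ArchWeight.a := by
    intro d
    induction d using Nat.strong_induction_on with
    | _ d IH =>
    intro hd2 K L _ _ _ _ _ _ hcyc hdL n N hn hK hL P π hAIP TP Tπ hTP hTπ σ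
    haveI : FiniteDimensional K L := Module.Finite.of_restrictScalars_finite ℚ K L
    haveI := hcyc
    by_cases hdprime : d.Prime
    · /- prime degree: `hprime` -/
      exact hprime K L hcyc (hdL ▸ hdprime) n N hn hK hL P π.1 hAIP TP Tπ hTP hTπ σ
    · /- composite degree: an intermediate field `K₁` with `[K₁ : K] = p` prime -/
      obtain ⟨p, hp, hpd⟩ := Nat.exists_prime_and_dvd (show d ≠ 1 by omega)
      have hcardG : Nat.card (L ≃ₐ[K] L) = d := (IsGalois.card_aut_eq_finrank K L).trans hdL
      -- a generator `x` of the Galois group; `g = x ^ p` has order `d / p`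
      obtain ⟨x, hx⟩ := IsCyclic.exists_ofOrder_eq_natCard (α := L ≃ₐ[K] L)
      rw [hcardG] at hx
      set g : L ≃ₐ[K] L := x ^ p with hgdef
      have hg : orderOf g = d / p := by
        rw [hgdef, orderOf_pow_of_dvd hp.ne_zero (hx ▸ hpd), hx]
      have hdp : d / p * p = d := Nat.div_mul_cancel hpd
      set H : Subgroup (L ≃ₐ[K] L) := Subgroup.zpowers g with hHdef
      have hH : Nat.card H = d / p := by rw [hHdef, Nat.card_zpowers, hg]
      -- `H` is normal (the Galois group is cyclic, hence commutative)
      haveI hHn : H.Normal := by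
        refine ⟨fun h hh g' => ?_⟩
        obtain ⟨y, hy⟩ := IsCyclic.exists_generator (α := L ≃ₐ[K] L)
        obtain ⟨a, rfl⟩ := hy g'
        obtain ⟨b, rfl⟩ := hy h
        rwa [← zpow_add, add_comm, zpow_add, mul_assoc, ← zpow_neg, ← zpow_add, add_neg_cancel,
          zpow_zero, mul_one]
      set K₁ : IntermediateField K L := IntermediateField.fixedField H with hK₁def
      haveI : IsGalois K K₁ := IsGalois.of_fixedField_normal_subgroup H
      haveI : NumberField K₁ := NumberField.of_module_finite K K₁
      haveI : IsGalois K₁ L := IsGalois.tower_top_of_isGalois K K₁ L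
      have hdegL : Module.finrank K₁ L = d / p := by
        rw [hK₁def, IntermediateField.finrank_fixedField_eq_card, hH]
      have hdegK : Module.finrank K K₁ = p := by
        have h := Module.finrank_mul_finrank K K₁ L
        rw [hdL, hdegL] at h
        refine Nat.eq_of_mul_eq_mul_right (Nat.div_pos (Nat.le_of_dvd (by omega) hpd) hp.pos) ?_
        rw [h]
        exact (Nat.mul_div_cancel' hpd).symm
      -- `Gal(L/K₁) ≅ H` and `Gal(K₁/K)` (a quotient of `Gal(L/K)`) are cyclic
      have hcycL : IsCyclic (L ≃ₐ[K₁] L) := by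
        haveI : IsCyclic K₁.fixingSubgroup := Subgroup.isCyclic _
        exact isCyclic_of_surjective (IntermediateField.fixingSubgroupEquiv K₁)
          (IntermediateField.fixingSubgroupEquiv K₁).surjective
      have hcycK : IsCyclic (K₁ ≃ₐ[K] K₁) :=
        isCyclic_of_surjective (AlgEquiv.restrictNormalHom (F := K) (K₁ := L) K₁)
          (AlgEquiv.restrictNormalHom_surjective L)
      -- `2 ≤ d / p < d`
      have hlt : d / p < d := Nat.div_lt_self (by omega) hp.one_lt
      have hge : 2 ≤ d / p := by
        by_contra hlt2
        have h1 : d / p = 1 := by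
          have hpos : 0 < d / p := Nat.div_pos (Nat.le_of_dvd (by omega) hpd) hp.pos
          omega
        rw [h1, one_mul] at hdp
        exact hdprime (hdp ▸ hp)
      -- `P₁ = π^{L/K₁}` (Arthur–Clozel Thm. 6.2), an infinity type of it, and `P` from `P₁`
      obtain ⟨P₁, hAI₁⟩ :=
        hAI n K₁ L hcycL hn hL (isCompact_glFiniteIntegralLevel_holds _ _) π
      have hAI' : IsAutomorphicInductionAlong P₁ P := hAIP.of_tower hAI₁
      obtain ⟨T₁, hT₁⟩ := hInf _ K₁ _ P₁
      -- the identities along `L/K₁` (induction hypothesis) and along `K₁/K` (`hprime`), composed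
      have hup := IH (d / p) hlt hge K₁ L hcycL hdegL n (n * Module.finrank K₁ L) hn
        (isCompact_glFiniteIntegralLevel_holds _ _) hL P₁ π hAI₁ T₁ Tπ hT₁ hTπ
      have hdown := hprime K K₁ hcycK (hdegK ▸ hp) (n * Module.finrank K₁ L) N
        (Nat.mul_pos hn Module.finrank_pos) hK (isCompact_glFiniteIntegralLevel_holds _ _) P P₁
        hAI' TP T₁ hTP hT₁
      exact henniartIdentity_tower (K₁ := K₁) hdown hup σ
  -- the named fact: degree `1` by `hOne`, degree `≥ 2` by `key`
  rw [Henniart2012_infinityType_of_automorphicInduction_iff_along]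
  intro K L _ _ _ _ _ _ hcyc n d hn hd hK hL P π hAIP TP Tπ hTP hTπ σ
  haveI : FiniteDimensional K L := Module.Finite.of_restrictScalars_finite ℚ K L
  rcases Nat.lt_or_ge d 2 with h1 | h2
  · obtain rfl : d = 1 := by
      have := Module.finrank_pos (R := K) (M := L); omega
    exact hOne K L n hn hd hK hL P π hAIP TP Tπ hTP hTπ σ
  · exact key d h2 K L hcyc hd n (d * n) hn hK hL P.1 π hAIP TP Tπ hTP hTπ σ

end ReductionGeneral

/-! ### Variant on archimedean (Harish-Chandra) parameters -/

section ReductionArchParameter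

/-- **Henniart's archimedean statement from its prime-degree instance stated on Harish-Chandra
parameters** (the level at which the tree states Arthur–Clozel's archimedean strong lifting,
`ArthurClozel1989_strongLifting_archimedean`). As
`Henniart2012_infinityType_of_automorphicInduction_of_prime_general` (stages, tower cut at the
bottom, intermediate inductions from Arthur–Clozel's Thm. 6.2 = `automorphicInduction_cyclic`),
but the induction runs on archimedean parameters `χ` (`AutomorphicRepData.HasArchParameter`), so
that the existence input is only `hArch`: every automorphic representation of `GL_N(𝔸_K)` has an
archimedean parameter (an infinitesimal character read through Harish-Chandra's isomorphism;
Borel–Jacquet 1979, 4.6 with Knapp 2002, Thm. 5.44; weaker than Clozel's existence of a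
well-formed infinity type, `AutomorphicRepData.exists_hasInfinityType`), and `hprime` reads: for
`L/K` cyclic of PRIME degree, `P` automorphic over `K` automorphically induced (Def. 6.1 a.e.) from
`ϖ` automorphic over `L`, and archimedean parameters `χ_P`, `χ_ϖ`:
`χ_P σ = ∑_{σ' ∣ σ} χ_ϖ σ'` (Henniart 2012, Thm. 5 and Remarque §3.7, with Thm. 3 (i), Thm. 4 and
rigidity, as explained there). `hOne` is the degree-one instance of the named fact. Infinity types
enter only at the end: `HasInfinityType T` is well-formedness plus `HasArchParameter` of the
`a`-multisets of `T`. [cite: Henniart2012, §3.1, Thm. 5 and Remarque §3.7]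
[cite: ArthurClozelAMS120, Ch. 3 Thm. 6.2, Thm. 5.1 and Ch. 1 §7] [cite: Clozel1990, §3.3] -/
theorem Henniart2012_infinityType_of_automorphicInduction_of_prime_archParameter
    (hprime : ∀ (K L : Type) [Field K] [NumberField K] [Field L] [NumberField L] [Algebra K L]
      [IsGalois K L], IsCyclic (L ≃ₐ[K] L) → (Module.finrank K L).Prime →
      ∀ (n N : ℕ), 0 < n →
      ∀ (hK : isCompact_glFiniteIntegralLevel N K) (hL : isCompact_glFiniteIntegralLevel n L)
        (P : AutomorphicRepData (AutomorphyDatum.gl N K hK))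
        (ϖ : AutomorphicRepData (AutomorphyDatum.gl n L hL)),
        IsAutomorphicInductionAlong ϖ P →
        ∀ (χP : (K →+* ℂ) → Multiset ℂ) (χϖ : (L →+* ℂ) → Multiset ℂ),
          P.HasArchParameter χP → ϖ.HasArchParameter χϖ →
          ∀ σ : K →+* ℂ,
            χP σ = ∑ σ' ∈ Finset.univ.filter (fun σ' : L →+* ℂ => σ'.comp (algebraMap K L) = σ),
              χϖ σ')
    (hOne : ∀ (K L : Type) [Field K] [NumberField K] [Field L] [NumberField L] [Algebra K L],
      ∀ (n : ℕ), 0 < n → Module.finrank K L = 1 →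
      ∀ (hK : isCompact_glFiniteIntegralLevel (1 * n) K)
        (hL : isCompact_glFiniteIntegralLevel n L)
        (P : CuspidalAutomorphicRepData (1 * n) K hK) (π : CuspidalAutomorphicRepData n L hL),
        IsAutomorphicInductionAlong π.1 P.1 →
        ∀ (TP : InfinityType K (1 * n)) (Tπ : InfinityType L n),
          P.1.HasInfinityType TP → π.1.HasInfinityType Tπ →
          ∀ σ : K →+* ℂ,
            (TP σ).map ArchWeight.a =
              ∑ σ' ∈ Finset.univ.filter (fun σ' : L →+* ℂ => σ'.comp (algebraMap K L) = σ),
                (Tπ σ').map ArchWeight.a)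
    (hAI : automorphicInduction_cyclic)
    (hArch : ∀ (N : ℕ) (K : Type) [Field K] [NumberField K]
      (hK : isCompact_glFiniteIntegralLevel N K) (P : AutomorphicRepData (AutomorphyDatum.gl N K hK)),
      ∃ χ : (K →+* ℂ) → Multiset ℂ, P.HasArchParameter χ) :
    Henniart2012_infinityType_of_automorphicInduction := by
  -- the statement on archimedean parameters, `L/K` cyclic of degree `d ≥ 2`, `P` automorphic of
  -- free rank, `π` cuspidal
  have key : ∀ d : ℕ, 2 ≤ d → ∀ (K L : Type) [Field K] [NumberField K] [Field L]
      [NumberField L] [Algebra K L] [IsGalois K L], IsCyclic (L ≃ₐ[K] L) →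
        Module.finrank K L = d → ∀ (n N : ℕ), 0 < n →
        ∀ (hK : isCompact_glFiniteIntegralLevel N K) (hL : isCompact_glFiniteIntegralLevel n L)
          (P : AutomorphicRepData (AutomorphyDatum.gl N K hK))
          (π : CuspidalAutomorphicRepData n L hL),
          IsAutomorphicInductionAlong π.1 P →
          ∀ (χP : (K →+* ℂ) → Multiset ℂ) (χπ : (L →+* ℂ) → Multiset ℂ),
            P.HasArchParameter χP → π.1.HasArchParameter χπ →
            ∀ σ : K →+* ℂ,
              χP σ = ∑ σ' ∈ Finset.univ.filter (fun σ' : L →+* ℂ => σ'.comp (algebraMap K L) = σ),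
                χπ σ' := by
    intro d
    induction d using Nat.strong_induction_on with
    | _ d IH =>
    intro hd2 K L _ _ _ _ _ _ hcyc hdL n N hn hK hL P π hAIP χP χπ hχP hχπ σ
    haveI : FiniteDimensional K L := Module.Finite.of_restrictScalars_finite ℚ K L
    haveI := hcyc
    by_cases hdprime : d.Prime
    · /- prime degree: `hprime` -/
      exact hprime K L hcyc (hdL ▸ hdprime) n N hn hK hL P π.1 hAIP χP χπ hχP hχπ σ
    · /- composite degree: an intermediate field `K₁` with `[K₁ : K] = p` prime -/
      obtain ⟨p, hp, hpd⟩ := Nat.exists_prime_and_dvd (show d ≠ 1 by omega)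
      have hcardG : Nat.card (L ≃ₐ[K] L) = d := (IsGalois.card_aut_eq_finrank K L).trans hdL
      obtain ⟨x, hx⟩ := IsCyclic.exists_ofOrder_eq_natCard (α := L ≃ₐ[K] L)
      rw [hcardG] at hx
      set g : L ≃ₐ[K] L := x ^ p with hgdef
      have hg : orderOf g = d / p := by
        rw [hgdef, orderOf_pow_of_dvd hp.ne_zero (hx ▸ hpd), hx]
      have hdp : d / p * p = d := Nat.div_mul_cancel hpd
      set H : Subgroup (L ≃ₐ[K] L) := Subgroup.zpowers g with hHdef
      have hH : Nat.card H = d / p := by rw [hHdef, Nat.card_zpowers, hg]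
      haveI hHn : H.Normal := by
        refine ⟨fun h hh g' => ?_⟩
        obtain ⟨y, hy⟩ := IsCyclic.exists_generator (α := L ≃ₐ[K] L)
        obtain ⟨a, rfl⟩ := hy g'
        obtain ⟨b, rfl⟩ := hy h
        rwa [← zpow_add, add_comm, zpow_add, mul_assoc, ← zpow_neg, ← zpow_add, add_neg_cancel,
          zpow_zero, mul_one]
      set K₁ : IntermediateField K L := IntermediateField.fixedField H with hK₁def
      haveI : IsGalois K K₁ := IsGalois.of_fixedField_normal_subgroup H
      haveI : NumberField K₁ := NumberField.of_module_finite K K₁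
      haveI : IsGalois K₁ L := IsGalois.tower_top_of_isGalois K K₁ L
      have hdegL : Module.finrank K₁ L = d / p := by
        rw [hK₁def, IntermediateField.finrank_fixedField_eq_card, hH]
      have hdegK : Module.finrank K K₁ = p := by
        have h := Module.finrank_mul_finrank K K₁ L
        rw [hdL, hdegL] at h
        refine Nat.eq_of_mul_eq_mul_right (Nat.div_pos (Nat.le_of_dvd (by omega) hpd) hp.pos) ?_
        rw [h]
        exact (Nat.mul_div_cancel' hpd).symm
      have hcycL : IsCyclic (L ≃ₐ[K₁] L) := by
        haveI : IsCyclic K₁.fixingSubgroup := Subgroup.isCyclic _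
        exact isCyclic_of_surjective (IntermediateField.fixingSubgroupEquiv K₁)
          (IntermediateField.fixingSubgroupEquiv K₁).surjective
      have hcycK : IsCyclic (K₁ ≃ₐ[K] K₁) :=
        isCyclic_of_surjective (AlgEquiv.restrictNormalHom (F := K) (K₁ := L) K₁)
          (AlgEquiv.restrictNormalHom_surjective L)
      have hlt : d / p < d := Nat.div_lt_self (by omega) hp.one_lt
      have hge : 2 ≤ d / p := by
        by_contra hlt2
        have h1 : d / p = 1 := by
          have hpos : 0 < d / p := Nat.div_pos (Nat.le_of_dvd (by omega) hpd) hp.pos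
          omega
        rw [h1, one_mul] at hdp
        exact hdprime (hdp ▸ hp)
      -- `P₁ = π^{L/K₁}` (Arthur–Clozel Thm. 6.2), an archimedean parameter of it, `P` from `P₁`
      obtain ⟨P₁, hAI₁⟩ :=
        hAI n K₁ L hcycL hn hL (isCompact_glFiniteIntegralLevel_holds _ _) π
      have hAI' : IsAutomorphicInductionAlong P₁ P := hAIP.of_tower hAI₁
      obtain ⟨χ₁, hχ₁⟩ := hArch _ K₁ _ P₁
      have hup := IH (d / p) hlt hge K₁ L hcycL hdegL n (n * Module.finrank K₁ L) hn
        (isCompact_glFiniteIntegralLevel_holds _ _) hL P₁ π hAI₁ χ₁ χπ hχ₁ hχπ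
      have hdown := hprime K K₁ hcycK (hdegK ▸ hp) (n * Module.finrank K₁ L) N
        (Nat.mul_pos hn Module.finrank_pos) hK (isCompact_glFiniteIntegralLevel_holds _ _) P P₁
        hAI' χP χ₁ hχP hχ₁
      rw [hdown σ, sum_filter_comp_algebraMap_tower K K₁ L χπ σ]
      exact Finset.sum_congr rfl fun σ' _ => hup σ'
  -- the named fact: degree `1` by `hOne`, degree `≥ 2` by `key` on the `a`-multisets
  rw [Henniart2012_infinityType_of_automorphicInduction_iff_along]
  intro K L _ _ _ _ _ _ hcyc n d hn hd hK hL P π hAIP TP Tπ hTP hTπ σ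
  haveI : FiniteDimensional K L := Module.Finite.of_restrictScalars_finite ℚ K L
  rcases Nat.lt_or_ge d 2 with h1 | h2
  · obtain rfl : d = 1 := by
      have := Module.finrank_pos (R := K) (M := L); omega
    exact hOne K L n hn hd hK hL P π hAIP TP Tπ hTP hTπ σ
  · exact key d h2 K L hcyc hd n (d * n) hn hK hL P.1 π hAIP (fun σ => (TP σ).map ArchWeight.a)
      (fun σ' => (Tπ σ').map ArchWeight.a) hTP.2 hTπ.2 σ

end ReductionArchParameter

/-! ### Variant with the existence input reduced to Schur's lemma for `W / W'` -/

section ReductionSchur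

/-- **Henniart's archimedean statement from its prime-degree instance, its degree-one instance,
Arthur–Clozel's Thm. 6.2 and Schur's lemma for automorphic representations.** As
`Henniart2012_infinityType_of_automorphicInduction_of_prime_archParameter`, with its existence
input `hArch` (every automorphic representation of `GL_N(𝔸_K)` has an archimedean parameter)
supplied by `AutomorphicRepData.exists_hasArchParameter_of_hasInfinitesimalCharacter` from
`hSchur`: the centre `Z(𝔤)` of `U(𝔤𝔩_N(K_∞))` acts on `W / W'` through a character
(`AutomorphicRepData.HasInfinitesimalCharacter`; Borel–Jacquet 1979, 4.6: an irreducible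
admissible `(𝔤, K_∞) × G(𝔸_f)`-module has an infinitesimal character — Dixmier–Schur). So the
named fact `Henniart2012_infinityType_of_automorphicInduction` holds granted: its prime-degree
instance on Harish-Chandra parameters (`hprime`: Henniart 2012 Thm. 5 and Remarque §3.7 with
Thm. 3 (i), Thm. 4 and rigidity), its degree-one instance (`hOne`: transport along `L ≅ K`),
Arthur–Clozel's Thm. 6.2 (`hAI = automorphicInduction_cyclic`, tree fact) and Schur's lemma for
`W / W'` (`hSchur`). [cite: Henniart2012, §3.1, Thm. 5 and Remarque §3.7]
[cite: ArthurClozelAMS120, Ch. 3 Thm. 6.2] [cite: BorelJacquet1979, 4.6] [cite: Clozel1990, §3.3] -/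
theorem Henniart2012_infinityType_of_automorphicInduction_of_prime_schur
    (hprime : ∀ (K L : Type) [Field K] [NumberField K] [Field L] [NumberField L] [Algebra K L]
      [IsGalois K L], IsCyclic (L ≃ₐ[K] L) → (Module.finrank K L).Prime →
      ∀ (n N : ℕ), 0 < n →
      ∀ (hK : isCompact_glFiniteIntegralLevel N K) (hL : isCompact_glFiniteIntegralLevel n L)
        (P : AutomorphicRepData (AutomorphyDatum.gl N K hK))
        (ϖ : AutomorphicRepData (AutomorphyDatum.gl n L hL)),
        IsAutomorphicInductionAlong ϖ P →
        ∀ (χP : (K →+* ℂ) → Multiset ℂ) (χϖ : (L →+* ℂ) → Multiset ℂ),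
          P.HasArchParameter χP → ϖ.HasArchParameter χϖ →
          ∀ σ : K →+* ℂ,
            χP σ = ∑ σ' ∈ Finset.univ.filter (fun σ' : L →+* ℂ => σ'.comp (algebraMap K L) = σ),
              χϖ σ')
    (hOne : ∀ (K L : Type) [Field K] [NumberField K] [Field L] [NumberField L] [Algebra K L],
      ∀ (n : ℕ), 0 < n → Module.finrank K L = 1 →
      ∀ (hK : isCompact_glFiniteIntegralLevel (1 * n) K)
        (hL : isCompact_glFiniteIntegralLevel n L)
        (P : CuspidalAutomorphicRepData (1 * n) K hK) (π : CuspidalAutomorphicRepData n L hL),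
        IsAutomorphicInductionAlong π.1 P.1 →
        ∀ (TP : InfinityType K (1 * n)) (Tπ : InfinityType L n),
          P.1.HasInfinityType TP → π.1.HasInfinityType Tπ →
          ∀ σ : K →+* ℂ,
            (TP σ).map ArchWeight.a =
              ∑ σ' ∈ Finset.univ.filter (fun σ' : L →+* ℂ => σ'.comp (algebraMap K L) = σ),
                (Tπ σ').map ArchWeight.a)
    (hAI : automorphicInduction_cyclic)
    (hSchur : ∀ (N : ℕ) (K : Type) [Field K] [NumberField K]
      (hK : isCompact_glFiniteIntegralLevel N K) (P : AutomorphicRepData (AutomorphyDatum.gl N K hK)),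
      ∃ θ : centerU (AutomorphyDatum.gl N K hK).arch →ₐ[ℝ] ℂ, P.HasInfinitesimalCharacter θ) :
    Henniart2012_infinityType_of_automorphicInduction :=
  Henniart2012_infinityType_of_automorphicInduction_of_prime_archParameter hprime hOne hAI
    fun N K _ _ hK P => by
      obtain ⟨θ, hθ⟩ := hSchur N K hK P
      exact P.exists_hasArchParameter_of_hasInfinitesimalCharacter hθ

end ReductionSchur

end Literature.NumberTheory.Automorphic
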